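import Summits.HodgeConjecture.HodgeConjecture.Theorems.HodgeLocusCensusSigmaFamilySmoothAll

/-!
# Hodge-locus census — the Σ-family perturbation lemma at e = 1 (d = 4), SHARPENED to every real N ≥ 2
# (THEOREM SM-∞'s range N ≥ 7 at d = 4 lowered to N ≥ 2, uniformly in k′ ≥ 3)

certified instances and evidence bearing on the general Hodge conjecture; no claim.

ENGINE B gen 40 (item B40-Σ♯; record `ENGINEB-g40.md`, derivation `gen40/DERIVATION-SHARP.md`; LEAD ruling R-L421).
Setting of `HodgeLocusCensusSigmaFamilySmoothAll` (THEOREM SM-∞, imported): coordinates `a b : ℂ`, `x y : ℕ → ℂ` (indices `< k`,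
`k = k′ ≥ 3`), here with `d = 4`, i.e. `e = d − 3 = 1`:
`F₀ = Σ_{j<k} (y_j x_j³ + y_j⁴) + a³ b + a b³`, `F₁ = −Σ_{j ≤ k−3} y_j x_{j+1}² x_{j+2} − y_{k−2} x_0 x_{k−1}² + a b x_0 x_1`, `F_N = N·F₀ + F₁`.
SM-∞ (`SigmaFamilySmoothAll.sigma_member_nonsingular`) proves `V(F_N) ⊂ ℙ^{2k+1}` smooth for real `N ≥ 2e + 5`, i.e. `N ≥ 7` at
`e = 1`, by a plain sup-norm perturbation argument (block bound `≥ m^{e+2}/2`, coupling bound `≤ (e+2)·m^{e+2}`).  This sheet proves the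
same conclusion at `e = 1` for every real `N ≥ 2` (`sigma_member_nonsingular_two_le`: SM-∞'s hypothesis list with `e` specialised to
`1` literally and `hN : 2 ≤ N`), so that the fifteen below-range census rows `N = 2..6` of the cells `(6,4,2)`, `(8,4,3)`, `(10,4,4)`
(`k′ = 3, 4, 5`) — so far recorded on CAS evidence (two implementations) — are instances of a kernel theorem over `ℂ`
(`sigma_row_6_4_2_N2` … `sigma_row_10_4_4_N6` in the companion sheet `…SmoothSharpRows`; `N = 1` of `(6,4,2)` is anchor
`HodgeLocusCensusSigmaFamilyK3NonsingularOne`).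
No census number changes; nothing about Hodge loci beyond SM-∞'s record.

METHOD (constants ours; every inequality is exact rational arithmetic, see `DERIVATION-SHARP.md`).  Let `m = max(‖a‖, ‖b‖, ‖x_i‖)`
(the y's are NOT in `m`) and `M = max ‖y_j‖`.  (0) `m = 0` ⇒ `∂F_N/∂y_j = 4N y_j³ = 0` ⇒ everything vanishes.  (1) `M ≥ (4/5)m`:
at the index `j` attaining `M`, `∂F_N/∂y_j = 0` gives `N(4M³ − m³) ≤ N‖x_j³ + 4y_j³‖ ≤ m³`, and `4·(4/5)³ = 256/125` gives
`(131/125)N ≤ 1` — false for `N ≥ 2`.  (2) `M < (4/5)m`, `‖a‖ = m` or `‖b‖ = m`: the BRACKET ALGEBRA of `∂F_N/∂a = ∂F_N/∂b = 0`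
(`bracket_d4`: `N‖a‖² ≤ ‖x₀x₁‖`, `N‖b‖² ≤ ‖x₀x₁‖`, `4N‖a‖‖b‖ ≤ ‖x₀x₁‖`; if `ab ≠ 0` the brackets force `a² = b²`, `x₀x₁ = −4Na²`)
gives `N m² ≤ m²` — false.  (3) `M < (4/5)m`, `‖x_i‖ = m`: (3b) if `‖y_i‖ < (9/20)m`, `∂F_N/∂y_i = 0` gives
`N(1 − 4·(9/20)³)m³ = (5084/8000)N m³ ≤ m³`, i.e. `N ≤ 8000/5084 < 1.574` — false; (3a) if `‖y_i‖ ≥ (9/20)m`, `∂F_N/∂x_i = 0` gives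
`3N m²‖y_i‖ = ‖∂F₁/∂x_i‖ ≤ 3M m² + ‖a‖‖b‖m ≤ (12/5)m³ + m³/(4N)` (the `ab`-monomial occurs only for `i = 0, 1`), hence
`(27/5)N² ≤ (48/5)N + 1`, whose largest root is `< 1.88` — false for `N ≥ 2` (the worst case of the analysis).
CONTENTS: `norm_sub_norm_le_norm_add`, `bracket_d4` (the bracket algebra), `sigma_member_nonsingular_d4` (the lemma in CLEAN SHAPE:
coefficients `3, 2, 4`, exponents as numerals), `sigma_member_nonsingular_two_le` (SM-∞'s LITERAL SHAPE at `e = 1`; an `example` checks that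
this hypothesis list is SM-∞'s statement at `e = 1` verbatim).  The named-variable cell corollaries (`k′ = 3, 4, 5`, real `N ≥ 2`) and the
fifteen census-row instances `N = 2..6` are the companion sheet `HodgeLocusCensusSigmaFamilySmoothSharpRows`.
Def-free; no `sorry`; default heartbeats; no `decide`/`native_decide`; imports only `HodgeLocusCensusSigmaFamilySmoothAll`.
-/

set_option linter.dupNamespace false

namespace Summit.HodgeConjecture.HodgeConjecture.HodgeLocus.Census.SigmaFamilySmoothSharp

/-- Reverse triangle inequality in the form used below: `‖p‖ − ‖q‖ ≤ ‖p + q‖`. -/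
theorem norm_sub_norm_le_norm_add (p q : ℂ) : ‖p‖ - ‖q‖ ≤ ‖p + q‖ := by
  have h := norm_add_le (p + q) (-q)
  rw [norm_neg, add_neg_cancel_right] at h
  linarith

/-- BRACKET ALGEBRA of the `(a, b)` block at `d = 4`.  From `∂F_N/∂a = N·b(3a² + b²) + b x₀x₁ = 0` and
`∂F_N/∂b = N·a(a² + 3b²) + a x₀x₁ = 0` with `N > 0`: `N‖a‖² ≤ ‖x₀‖‖x₁‖`, `N‖b‖² ≤ ‖x₀‖‖x₁‖` and `4N‖a‖‖b‖ ≤ ‖x₀‖‖x₁‖`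
(if `a b ≠ 0` the two brackets `N(3a² + b²) + x₀x₁ = N(a² + 3b²) + x₀x₁ = 0` force `a² = b²` and `x₀x₁ = −4N a²`). -/
theorem bracket_d4 (N : ℝ) (hN : 0 < N) (a b x0 x1 : ℂ)
    (Ha : (N : ℂ) * (b * (3 * a ^ 2 + b ^ 2)) + b * x0 * x1 = 0)
    (Hb : (N : ℂ) * (a * (a ^ 2 + 3 * b ^ 2)) + a * x0 * x1 = 0) :
    N * ‖a‖ ^ 2 ≤ ‖x0‖ * ‖x1‖ ∧ N * ‖b‖ ^ 2 ≤ ‖x0‖ * ‖x1‖ ∧ 4 * N * (‖a‖ * ‖b‖) ≤ ‖x0‖ * ‖x1‖ := by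
  have hNC : ‖(N : ℂ)‖ = N := by rw [Complex.norm_real, Real.norm_of_nonneg hN.le]
  have hx : ‖x0 * x1‖ = ‖x0‖ * ‖x1‖ := norm_mul _ _
  have h0 : 0 ≤ ‖x0‖ * ‖x1‖ := by positivity
  by_cases ha : a = 0
  · subst ha
    by_cases hb : b = 0
    · subst hb
      exact ⟨by simpa using h0, by simpa using h0, by simpa using h0⟩
    · have h1 : (N : ℂ) * b ^ 2 = -(x0 * x1) := by
        have h2 : b * ((N : ℂ) * b ^ 2 + x0 * x1) = 0 := by linear_combination Ha
        have h3 := (mul_eq_zero.mp h2).resolve_left hb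
        linear_combination h3
      have h2 : N * ‖b‖ ^ 2 = ‖x0‖ * ‖x1‖ := by
        have h3 := congrArg Norm.norm h1
        rw [norm_mul, hNC, norm_pow, norm_neg, hx] at h3
        exact h3
      exact ⟨by simpa using h0, h2.le, by simpa using h0⟩
  · by_cases hb : b = 0
    · subst hb
      have h1 : (N : ℂ) * a ^ 2 = -(x0 * x1) := by
        have h2 : a * ((N : ℂ) * a ^ 2 + x0 * x1) = 0 := by linear_combination Hb
        have h3 := (mul_eq_zero.mp h2).resolve_left ha
        linear_combination h3
      have h2 : N * ‖a‖ ^ 2 = ‖x0‖ * ‖x1‖ := by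
        have h3 := congrArg Norm.norm h1
        rw [norm_mul, hNC, norm_pow, norm_neg, hx] at h3
        exact h3
      exact ⟨h2.le, by simpa using h0, by simpa using h0⟩
    · -- `a ≠ 0`, `b ≠ 0`: the two brackets
      have e1 : (N : ℂ) * (3 * a ^ 2 + b ^ 2) + x0 * x1 = 0 := by
        have h2 : b * ((N : ℂ) * (3 * a ^ 2 + b ^ 2) + x0 * x1) = 0 := by linear_combination Ha
        exact (mul_eq_zero.mp h2).resolve_left hb
      have e2 : (N : ℂ) * (a ^ 2 + 3 * b ^ 2) + x0 * x1 = 0 := by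
        have h2 : a * ((N : ℂ) * (a ^ 2 + 3 * b ^ 2) + x0 * x1) = 0 := by linear_combination Hb
        exact (mul_eq_zero.mp h2).resolve_left ha
      have hN0 : (N : ℂ) ≠ 0 := by exact_mod_cast hN.ne'
      have e3 : a ^ 2 = b ^ 2 := by
        have h2 : (N : ℂ) * (2 * (a ^ 2 - b ^ 2)) = 0 := by linear_combination e1 - e2
        have h3 := (mul_eq_zero.mp h2).resolve_left hN0
        linear_combination h3 / 2
      have n1 : ‖x0‖ * ‖x1‖ = 4 * N * ‖a‖ ^ 2 := by
        have h2 : x0 * x1 = ((4 * N : ℝ) : ℂ) * -(a ^ 2) := by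
          push_cast; linear_combination e1 + (N : ℂ) * e3
        rw [← hx, h2, norm_mul, norm_neg, norm_pow, Complex.norm_real, Real.norm_of_nonneg (by positivity)]
      have n2 : ‖x0‖ * ‖x1‖ = 4 * N * ‖b‖ ^ 2 := by
        have h2 : x0 * x1 = ((4 * N : ℝ) : ℂ) * -(b ^ 2) := by
          push_cast; linear_combination e2 - (N : ℂ) * e3
        rw [← hx, h2, norm_mul, norm_neg, norm_pow, Complex.norm_real, Real.norm_of_nonneg (by positivity)]
      have p1 : 0 ≤ N * ‖a‖ ^ 2 := by positivity
      have p2 : 0 ≤ N * ‖b‖ ^ 2 := by positivity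
      have p3 : 0 ≤ N * (‖a‖ - ‖b‖) ^ 2 := by positivity
      refine ⟨by linarith, by linarith, by nlinarith [p3]⟩

/-- The Σ-family perturbation lemma at `d = 4` for every real `N ≥ 2` and every `k ≥ 3`, CLEAN SHAPE: the `2k + 2` partial
derivatives of `F_N = N·F₀ + F₁` at `e = 1` (coefficients `3, 2, 4` and exponents written as numerals; the `∂F₁` parts by cases on the
index, exactly as in SM-∞) do not vanish simultaneously at a point with `(a, b, x_0..x_{k−1}, y_0..y_{k−1}) ≠ 0`. -/
theorem sigma_member_nonsingular_d4 (k : ℕ) (hk : 3 ≤ k) (N : ℝ) (hN : 2 ≤ N)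
    (a b : ℂ) (x y : ℕ → ℂ)
    (hne : ¬ (a = 0 ∧ b = 0 ∧ ∀ i < k, x i = 0 ∧ y i = 0)) :
    ¬ ( (N : ℂ) * (b * (3 * a ^ 2 + b ^ 2)) + b * x 0 * x 1 = 0 ∧
        (N : ℂ) * (a * (a ^ 2 + 3 * b ^ 2)) + a * x 0 * x 1 = 0 ∧
        (∀ i < k, (N : ℂ) * (3 * x i ^ 2 * y i) +
            (if i = 0 then -(y (k - 2) * x (k - 1) ^ 2) + a * b * x 1
             else if i = 1 then -(2 * y 0 * x 1 * x 2) + a * b * x 0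
             else if i + 1 < k then -(y (i - 2) * x (i - 1) ^ 2) - 2 * y (i - 1) * x i * x (i + 1)
             else -(y (k - 3) * x (k - 2) ^ 2) - 2 * y (k - 2) * x 0 * x (k - 1)) = 0) ∧
        (∀ j < k, (N : ℂ) * (x j ^ 3 + 4 * y j ^ 3) +
            (if j + 3 ≤ k then -(x (j + 1) ^ 2 * x (j + 2))
             else if j + 2 = k then -(x 0 * x (k - 1) ^ 2)
             else 0) = 0) ) := by
  rintro ⟨Ha, Hb, Hx, Hy⟩
  have hk0 : 0 < k := by omega
  have hk1 : 1 < k := by omega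
  have hk2 : 2 < k := by omega
  have hNpos : (0 : ℝ) < N := by linarith
  have hNC : ‖(N : ℂ)‖ = N := by rw [Complex.norm_real, Real.norm_of_nonneg hNpos.le]
  -- the sup norm `m` of the coordinates (a, b, x_0, …, x_{k−1}) and an index attaining it
  let f : ℕ → ℝ := fun n => if n = 0 then ‖a‖ else if n = 1 then ‖b‖ else ‖x (n - 2)‖
  obtain ⟨n₀, hn₀, hmax⟩ := Finset.exists_max_image (Finset.range (k + 2)) f ⟨0, by simp⟩
  have hn₀' : n₀ < k + 2 := Finset.mem_range.mp hn₀
  have key : ∀ n, n < k + 2 → f n ≤ f n₀ := fun n hn => hmax n (Finset.mem_range.mpr hn)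
  generalize hm_def : f n₀ = m at key
  have hA : ‖a‖ ≤ m := by have h := key 0 (by omega); simpa [f] using h
  have hB : ‖b‖ ≤ m := by have h := key 1 (by omega); simpa [f] using h
  have hX : ∀ i < k, ‖x i‖ ≤ m := by
    intro i hi
    have h := key (i + 2) (by omega)
    simp only [f, show ¬ (i + 2 = 0) from by omega, show ¬ (i + 2 = 1) from by omega, if_false,
      Nat.add_sub_cancel] at h
    exact h
  have hm0 : 0 ≤ m := (norm_nonneg a).trans hA
  -- the sup norm `M` of the coordinates (y_0, …, y_{k−1}) and an index attaining it
  obtain ⟨j₀, hj₀, hjmax⟩ :=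
    Finset.exists_max_image (Finset.range k) (fun j => ‖y j‖) ⟨0, Finset.mem_range.mpr hk0⟩
  have hj₀' : j₀ < k := Finset.mem_range.mp hj₀
  have hY : ∀ j < k, ‖y j‖ ≤ ‖y j₀‖ := fun j hj => hjmax j (Finset.mem_range.mpr hj)
  generalize hM_def : ‖y j₀‖ = M at hY
  have hM0 : 0 ≤ M := by rw [← hM_def]; exact norm_nonneg _
  -- coupling bound ‖∂F₁/∂y_j‖ ≤ m³ (products of x's only)
  have cy : ∀ j < k, ‖(if j + 3 ≤ k then -(x (j + 1) ^ 2 * x (j + 2))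
             else if j + 2 = k then -(x 0 * x (k - 1) ^ 2) else 0)‖ ≤ m ^ 3 := by
    intro j hj
    split_ifs with h3 h2
    · calc ‖-(x (j + 1) ^ 2 * x (j + 2))‖ = ‖x (j + 1)‖ ^ 2 * ‖x (j + 2)‖ := by rw [norm_neg, norm_mul, norm_pow]
        _ ≤ m ^ 2 * m := by gcongr; exacts [hX (j + 1) (by omega), hX (j + 2) (by omega)]
        _ = m ^ 3 := by ring
    · calc ‖-(x 0 * x (k - 1) ^ 2)‖ = ‖x 0‖ * ‖x (k - 1)‖ ^ 2 := by rw [norm_neg, norm_mul, norm_pow]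
        _ ≤ m * m ^ 2 := by gcongr; exacts [hX 0 hk0, hX (k - 1) (by omega)]
        _ = m ^ 3 := by ring
    · rw [norm_zero]; exact pow_nonneg hm0 3
  -- coupling bound ‖∂F₁/∂x_i‖ ≤ 3·M·m² + ‖a‖‖b‖·m, by position of i (the `ab`-monomial occurs only for i = 0, 1)
  have cx : ∀ i < k, ‖(if i = 0 then -(y (k - 2) * x (k - 1) ^ 2) + a * b * x 1
             else if i = 1 then -(2 * y 0 * x 1 * x 2) + a * b * x 0
             else if i + 1 < k then -(y (i - 2) * x (i - 1) ^ 2) - 2 * y (i - 1) * x i * x (i + 1)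
             else -(y (k - 3) * x (k - 2) ^ 2) - 2 * y (k - 2) * x 0 * x (k - 1))‖
             ≤ 3 * M * m ^ 2 + ‖a‖ * ‖b‖ * m := by
    have hMm : 0 ≤ M * m ^ 2 := by positivity
    have hab : 0 ≤ ‖a‖ * ‖b‖ * m := by positivity
    intro i hi
    split_ifs with h0 h1 h2
    · -- i = 0
      have t1 : ‖-(y (k - 2) * x (k - 1) ^ 2)‖ ≤ M * m ^ 2 := by
        calc ‖-(y (k - 2) * x (k - 1) ^ 2)‖ = ‖y (k - 2)‖ * ‖x (k - 1)‖ ^ 2 := by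
              rw [norm_neg, norm_mul, norm_pow]
          _ ≤ M * m ^ 2 := by gcongr; exacts [hY (k - 2) (by omega), hX (k - 1) (by omega)]
      have t2 : ‖a * b * x 1‖ ≤ ‖a‖ * ‖b‖ * m := by
        calc ‖a * b * x 1‖ = ‖a‖ * ‖b‖ * ‖x 1‖ := by rw [norm_mul, norm_mul]
          _ ≤ ‖a‖ * ‖b‖ * m := by gcongr; exact hX 1 hk1
      calc _ ≤ ‖-(y (k - 2) * x (k - 1) ^ 2)‖ + ‖a * b * x 1‖ := norm_add_le _ _
        _ ≤ M * m ^ 2 + ‖a‖ * ‖b‖ * m := add_le_add t1 t2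
        _ ≤ 3 * M * m ^ 2 + ‖a‖ * ‖b‖ * m := by linarith
    · -- i = 1
      have t1 : ‖-(2 * y 0 * x 1 * x 2)‖ ≤ 2 * M * m ^ 2 := by
        calc ‖-(2 * y 0 * x 1 * x 2)‖ = 2 * ‖y 0‖ * ‖x 1‖ * ‖x 2‖ := by
              rw [norm_neg, norm_mul, norm_mul, norm_mul, Complex.norm_two]
          _ ≤ 2 * M * m * m := by gcongr; exacts [hY 0 hk0, hX 1 hk1, hX 2 hk2]
          _ = 2 * M * m ^ 2 := by ring
      have t2 : ‖a * b * x 0‖ ≤ ‖a‖ * ‖b‖ * m := by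
        calc ‖a * b * x 0‖ = ‖a‖ * ‖b‖ * ‖x 0‖ := by rw [norm_mul, norm_mul]
          _ ≤ ‖a‖ * ‖b‖ * m := by gcongr; exact hX 0 hk0
      calc _ ≤ ‖-(2 * y 0 * x 1 * x 2)‖ + ‖a * b * x 0‖ := norm_add_le _ _
        _ ≤ 2 * M * m ^ 2 + ‖a‖ * ‖b‖ * m := add_le_add t1 t2
        _ ≤ 3 * M * m ^ 2 + ‖a‖ * ‖b‖ * m := by linarith
    · -- 2 ≤ i ≤ k − 2
      have t1 : ‖-(y (i - 2) * x (i - 1) ^ 2)‖ ≤ M * m ^ 2 := by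
        calc ‖-(y (i - 2) * x (i - 1) ^ 2)‖ = ‖y (i - 2)‖ * ‖x (i - 1)‖ ^ 2 := by
              rw [norm_neg, norm_mul, norm_pow]
          _ ≤ M * m ^ 2 := by gcongr; exacts [hY (i - 2) (by omega), hX (i - 1) (by omega)]
      have t2 : ‖2 * y (i - 1) * x i * x (i + 1)‖ ≤ 2 * M * m ^ 2 := by
        calc ‖2 * y (i - 1) * x i * x (i + 1)‖ = 2 * ‖y (i - 1)‖ * ‖x i‖ * ‖x (i + 1)‖ := by
              rw [norm_mul, norm_mul, norm_mul, Complex.norm_two]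
          _ ≤ 2 * M * m * m := by gcongr; exacts [hY (i - 1) (by omega), hX i hi, hX (i + 1) h2]
          _ = 2 * M * m ^ 2 := by ring
      calc _ ≤ ‖-(y (i - 2) * x (i - 1) ^ 2)‖ + ‖2 * y (i - 1) * x i * x (i + 1)‖ := norm_sub_le _ _
        _ ≤ M * m ^ 2 + 2 * M * m ^ 2 := add_le_add t1 t2
        _ ≤ 3 * M * m ^ 2 + ‖a‖ * ‖b‖ * m := by linarith
    · -- i = k − 1
      have t1 : ‖-(y (k - 3) * x (k - 2) ^ 2)‖ ≤ M * m ^ 2 := by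
        calc ‖-(y (k - 3) * x (k - 2) ^ 2)‖ = ‖y (k - 3)‖ * ‖x (k - 2)‖ ^ 2 := by
              rw [norm_neg, norm_mul, norm_pow]
          _ ≤ M * m ^ 2 := by gcongr; exacts [hY (k - 3) (by omega), hX (k - 2) (by omega)]
      have t2 : ‖2 * y (k - 2) * x 0 * x (k - 1)‖ ≤ 2 * M * m ^ 2 := by
        calc ‖2 * y (k - 2) * x 0 * x (k - 1)‖ = 2 * ‖y (k - 2)‖ * ‖x 0‖ * ‖x (k - 1)‖ := by
              rw [norm_mul, norm_mul, norm_mul, Complex.norm_two]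
          _ ≤ 2 * M * m * m := by gcongr; exacts [hY (k - 2) (by omega), hX 0 hk0, hX (k - 1) (by omega)]
          _ = 2 * M * m ^ 2 := by ring
      calc _ ≤ ‖-(y (k - 3) * x (k - 2) ^ 2)‖ + ‖2 * y (k - 2) * x 0 * x (k - 1)‖ := norm_sub_le _ _
        _ ≤ M * m ^ 2 + 2 * M * m ^ 2 := add_le_add t1 t2
        _ ≤ 3 * M * m ^ 2 + ‖a‖ * ‖b‖ * m := by linarith
  -- the vanishing of ∂F_N/∂y_j resp. ∂F_N/∂x_i in norm form
  have hyN : ∀ j < k, N * ‖x j ^ 3 + 4 * y j ^ 3‖ ≤ m ^ 3 := by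
    intro j hj
    have h := congrArg Norm.norm (eq_neg_of_add_eq_zero_left (Hy j hj))
    rw [norm_neg, norm_mul, hNC] at h
    rw [h]; exact cy j hj
  have hxN : ∀ i < k, N * (3 * ‖x i‖ ^ 2 * ‖y i‖) ≤ 3 * M * m ^ 2 + ‖a‖ * ‖b‖ * m := by
    intro i hi
    have h := congrArg Norm.norm (eq_neg_of_add_eq_zero_left (Hx i hi))
    rw [norm_neg, norm_mul, norm_mul, norm_mul, norm_pow, hNC, Complex.norm_ofNat] at h
    rw [h]; exact cx i hi
  rcases eq_or_lt_of_le hm0 with hm_eq | hm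
  · -- (0) m = 0: a = b = x = 0, and ∂F_N/∂y_j = 4N·y_j³ = 0 forces y = 0 — contradicting `hne`
    subst hm_eq
    apply hne
    refine ⟨norm_le_zero_iff.mp hA, norm_le_zero_iff.mp hB, fun i hi => ⟨norm_le_zero_iff.mp (hX i hi), ?_⟩⟩
    have hx0 : x i = 0 := norm_le_zero_iff.mp (hX i hi)
    have h := hyN i hi
    simp only [hx0, ne_eq, OfNat.ofNat_ne_zero, not_false_eq_true, zero_pow, zero_add, norm_mul, norm_pow,
      Complex.norm_ofNat] at h
    have h3 : ‖y i‖ ^ 3 ≤ 0 := by nlinarith [h]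
    have h4 : ‖y i‖ ^ 3 = 0 := le_antisymm h3 (pow_nonneg (norm_nonneg _) 3)
    exact norm_eq_zero.mp ((pow_eq_zero_iff three_ne_zero).mp h4)
  · rcases le_or_gt (4 / 5 * m) M with hMy | hMy
    · -- (1) the y-block dominates, M ≥ (4/5)m: ∂F_N/∂y at the index j₀ attaining M gives N(4M³ − m³) ≤ m³
      have h1 := hyN j₀ hj₀'
      have h2 : 4 * M ^ 3 - m ^ 3 ≤ ‖x j₀ ^ 3 + 4 * y j₀ ^ 3‖ := by
        have e1 : ‖(4 : ℂ) * y j₀ ^ 3‖ = 4 * M ^ 3 := by rw [norm_mul, norm_pow, Complex.norm_ofNat, hM_def]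
        have e2 : ‖x j₀ ^ 3‖ ≤ m ^ 3 := by rw [norm_pow]; exact pow_le_pow_left₀ (norm_nonneg _) (hX j₀ hj₀') 3
        have e3 := norm_sub_norm_le_norm_add ((4 : ℂ) * y j₀ ^ 3) (x j₀ ^ 3)
        rw [add_comm ((4 : ℂ) * y j₀ ^ 3)] at e3
        linarith
      have h3 : N * (4 * M ^ 3 - m ^ 3) ≤ m ^ 3 := le_trans (mul_le_mul_of_nonneg_left h2 hNpos.le) h1
      have h4 : (4 / 5 * m) ^ 3 ≤ M ^ 3 := pow_le_pow_left₀ (by positivity) hMy 3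
      have hm3 : 0 < m ^ 3 := pow_pos hm 3
      -- (131/125)·N·m³ ≤ m³ with N ≥ 2, m³ > 0: impossible
      nlinarith [h3, mul_le_mul_of_nonneg_left h4 hNpos.le, mul_le_mul_of_nonneg_left hN hm3.le, hm3]
    · -- M < (4/5)m; which of a, b, x_i attains m?
      rcases Nat.lt_or_ge n₀ 2 with h01 | hge2
      · -- (2) the (a,b) block attains m: bracket algebra gives N·m² ≤ ‖x₀‖‖x₁‖ ≤ m²
        obtain ⟨bra, brb, -⟩ := bracket_d4 N hNpos a b (x 0) (x 1) Ha Hb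
        have hxx : ‖x 0‖ * ‖x 1‖ ≤ m * m := mul_le_mul (hX 0 hk0) (hX 1 hk1) (norm_nonneg _) hm.le
        have hmm : 0 < m * m := mul_pos hm hm
        have hab : ‖a‖ = m ∨ ‖b‖ = m := by
          interval_cases n₀
          · left; simpa [f] using hm_def
          · right; simpa [f] using hm_def
        rcases hab with h | h
        · rw [h] at bra; nlinarith [mul_le_mul_of_nonneg_left hN hmm.le]
        · rw [h] at brb; nlinarith [mul_le_mul_of_nonneg_left hN hmm.le]
      · -- (3) x_i attains m, i = n₀ − 2
        have hi : n₀ - 2 < k := by omega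
        have hxi : ‖x (n₀ - 2)‖ = m := by
          simp only [f, show ¬ (n₀ = 0) from by omega, show ¬ (n₀ = 1) from by omega, if_false] at hm_def
          exact hm_def
        have hm3 : 0 < m ^ 3 := pow_pos hm 3
        rcases le_or_gt (9 / 20 * m) ‖y (n₀ - 2)‖ with hyi | hyi
        · -- (3a) ‖y_i‖ ≥ (9/20)m: ∂F_N/∂x_i gives 3N m²‖y_i‖ ≤ 3Mm² + ‖a‖‖b‖m, 4N‖a‖‖b‖ ≤ ‖x₀‖‖x₁‖ ≤ m², M < (4/5)m
          have h1 := hxN (n₀ - 2) hi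
          rw [hxi] at h1
          obtain ⟨-, -, brab⟩ := bracket_d4 N hNpos a b (x 0) (x 1) Ha Hb
          have hxx : ‖x 0‖ * ‖x 1‖ ≤ m * m := mul_le_mul (hX 0 hk0) (hX 1 hk1) (norm_nonneg _) hm.le
          have hP : 4 * N * (‖a‖ * ‖b‖) ≤ m * m := brab.trans hxx
          have s1 : N * (3 * m ^ 2 * (9 / 20 * m)) ≤ N * (3 * m ^ 2 * ‖y (n₀ - 2)‖) :=
            mul_le_mul_of_nonneg_left (mul_le_mul_of_nonneg_left hyi (by positivity)) hNpos.le
          have t2 : 4 * N * (‖a‖ * ‖b‖ * m) ≤ m ^ 3 := by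
            calc 4 * N * (‖a‖ * ‖b‖ * m) = (4 * N * (‖a‖ * ‖b‖)) * m := by ring
              _ ≤ (m * m) * m := mul_le_mul_of_nonneg_right hP hm.le
              _ = m ^ 3 := by ring
          have t3 : 3 * M * m ^ 2 ≤ 12 / 5 * m ^ 3 := by
            calc 3 * M * m ^ 2 ≤ 3 * (4 / 5 * m) * m ^ 2 := by gcongr
              _ = 12 / 5 * m ^ 3 := by ring
          have h4N : (0 : ℝ) ≤ 4 * N := by positivity
          have t4 : 4 * N * (N * (3 * m ^ 2 * (9 / 20 * m))) ≤ 4 * N * (12 / 5 * m ^ 3) + m ^ 3 := by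
            have u1 := mul_le_mul_of_nonneg_left (s1.trans h1) h4N
            have u2 := mul_le_mul_of_nonneg_left t3 h4N
            linarith
          -- i.e. (27/5)N²·m³ ≤ ((48/5)N + 1)·m³; divide by m³ > 0 and contradict N ≥ 2
          have t5 : 27 / 5 * N ^ 2 ≤ 48 / 5 * N + 1 := by
            have u : (27 / 5 * N ^ 2) * m ^ 3 ≤ (48 / 5 * N + 1) * m ^ 3 := by linarith
            exact le_of_mul_le_mul_right u hm3
          nlinarith [t5, sq_nonneg (N - 2)]
        · -- (3b) ‖y_i‖ < (9/20)m: ∂F_N/∂y_i gives N(m³ − 4‖y_i‖³) ≤ N‖x_i³ + 4y_i³‖ ≤ m³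
          have h1 := hyN (n₀ - 2) hi
          have h2 : m ^ 3 - 4 * ‖y (n₀ - 2)‖ ^ 3 ≤ ‖x (n₀ - 2) ^ 3 + 4 * y (n₀ - 2) ^ 3‖ := by
            have e1 : ‖x (n₀ - 2) ^ 3‖ = m ^ 3 := by rw [norm_pow, hxi]
            have e2 : ‖(4 : ℂ) * y (n₀ - 2) ^ 3‖ = 4 * ‖y (n₀ - 2)‖ ^ 3 := by
              rw [norm_mul, norm_pow, Complex.norm_ofNat]
            have e3 := norm_sub_norm_le_norm_add (x (n₀ - 2) ^ 3) ((4 : ℂ) * y (n₀ - 2) ^ 3)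
            linarith
          have h3 : N * (m ^ 3 - 4 * ‖y (n₀ - 2)‖ ^ 3) ≤ m ^ 3 := le_trans (mul_le_mul_of_nonneg_left h2 hNpos.le) h1
          have h4 : ‖y (n₀ - 2)‖ ^ 3 ≤ (9 / 20 * m) ^ 3 := pow_le_pow_left₀ (norm_nonneg _) hyi.le 3
          -- (5084/8000)·N·m³ ≤ m³ with N ≥ 2, m³ > 0: impossible
          nlinarith [h3, mul_le_mul_of_nonneg_left h4 hNpos.le, mul_le_mul_of_nonneg_left hN hm3.le, hm3]

/-- The Σ-family perturbation lemma at `e = 1` (`d = 4`) for every real `N ≥ 2` and every `k ≥ 3`, in the LITERAL SHAPE of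
THEOREM SM-∞: the hypothesis list of `SigmaFamilySmoothAll.sigma_member_nonsingular` with `e` specialised to `1` (so that row
instances apply unchanged) and `hN : 2 ≤ N` in place of `hN : 2e + 5 ≤ N`.  `V(F_N) ⊂ ℙ^{2k+1}` is smooth for every real `N ≥ 2`. -/
theorem sigma_member_nonsingular_two_le (k : ℕ) (hk : 3 ≤ k) (N : ℝ) (hN : 2 ≤ N)
    (a b : ℂ) (x y : ℕ → ℂ)
    (hne : ¬ (a = 0 ∧ b = 0 ∧ ∀ i < k, x i = 0 ∧ y i = 0)) :
    ¬ ( (N : ℂ) * (b * ((((1 : ℕ) : ℂ) + 2) * a ^ (1 + 1) + b ^ (1 + 1))) + b * x 0 ^ 1 * x 1 = 0 ∧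
        (N : ℂ) * (a * (a ^ (1 + 1) + (((1 : ℕ) : ℂ) + 2) * b ^ (1 + 1))) + a * x 0 ^ 1 * x 1 = 0 ∧
        (∀ i < k, (N : ℂ) * ((((1 : ℕ) : ℂ) + 2) * x i ^ (1 + 1) * y i) +
            (if i = 0 then -(y (k - 2) * x (k - 1) ^ (1 + 1)) + ((1 : ℕ) : ℂ) * a * b * x 0 ^ (1 - 1) * x 1
             else if i = 1 then -((((1 : ℕ) : ℂ) + 1) * y 0 * x 1 ^ 1 * x 2) + a * b * x 0 ^ 1
             else if i + 1 < k then -(y (i - 2) * x (i - 1) ^ (1 + 1)) - (((1 : ℕ) : ℂ) + 1) * y (i - 1) * x i ^ 1 * x (i + 1)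
             else -(y (k - 3) * x (k - 2) ^ (1 + 1)) - (((1 : ℕ) : ℂ) + 1) * y (k - 2) * x 0 * x (k - 1) ^ 1) = 0) ∧
        (∀ j < k, (N : ℂ) * (x j ^ (1 + 2) + (((1 : ℕ) : ℂ) + 3) * y j ^ (1 + 2)) +
            (if j + 3 ≤ k then -(x (j + 1) ^ (1 + 1) * x (j + 2))
             else if j + 2 = k then -(x 0 * x (k - 1) ^ (1 + 1))
             else 0) = 0) ) := by
  rintro ⟨Ha, Hb, Hx, Hy⟩
  refine sigma_member_nonsingular_d4 k hk N hN a b x y hne ⟨?_, ?_, ?_, ?_⟩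
  · simp only [Nat.cast_one, pow_one] at Ha
    linear_combination Ha
  · simp only [Nat.cast_one, pow_one] at Hb
    linear_combination Hb
  · intro i hi
    have h := Hx i hi
    split_ifs at h ⊢
    · simp only [Nat.cast_one, Nat.sub_self, pow_zero, mul_one] at h
      linear_combination h
    · simp only [Nat.cast_one, pow_one] at h
      linear_combination h
    · simp only [Nat.cast_one, pow_one] at h
      linear_combination h
    · simp only [Nat.cast_one, pow_one] at h
      linear_combination h
  · intro j hj
    have h := Hy j hj
    split_ifs at h ⊢
    · simp only [Nat.cast_one] at h
      linear_combination h
    · simp only [Nat.cast_one] at h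
      linear_combination h
    · simp only [Nat.cast_one] at h
      linear_combination h

/- CONSISTENCY WITH SM-∞ (an `example`, kernel-checked at build time, no declaration): the hypothesis list of
`sigma_member_nonsingular_two_le` IS the statement of THEOREM SM-∞ (`SigmaFamilySmoothAll.sigma_member_nonsingular`) at `e = 1` —
SM-∞'s own term at `e = 1` proves the literal statement verbatim on SM-∞'s range `N ≥ 2·1 + 5` (and there `7 ≥ 2`, so the sharpened
lemma gives it back). -/
example (k : ℕ) (hk : 3 ≤ k) (N : ℝ) (hN : 2 * ((1 : ℕ) : ℝ) + 5 ≤ N) (a b : ℂ) (x y : ℕ → ℂ)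
    (hne : ¬ (a = 0 ∧ b = 0 ∧ ∀ i < k, x i = 0 ∧ y i = 0)) :
    ¬ ( (N : ℂ) * (b * ((((1 : ℕ) : ℂ) + 2) * a ^ (1 + 1) + b ^ (1 + 1))) + b * x 0 ^ 1 * x 1 = 0 ∧
        (N : ℂ) * (a * (a ^ (1 + 1) + (((1 : ℕ) : ℂ) + 2) * b ^ (1 + 1))) + a * x 0 ^ 1 * x 1 = 0 ∧
        (∀ i < k, (N : ℂ) * ((((1 : ℕ) : ℂ) + 2) * x i ^ (1 + 1) * y i) +
            (if i = 0 then -(y (k - 2) * x (k - 1) ^ (1 + 1)) + ((1 : ℕ) : ℂ) * a * b * x 0 ^ (1 - 1) * x 1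
             else if i = 1 then -((((1 : ℕ) : ℂ) + 1) * y 0 * x 1 ^ 1 * x 2) + a * b * x 0 ^ 1
             else if i + 1 < k then -(y (i - 2) * x (i - 1) ^ (1 + 1)) - (((1 : ℕ) : ℂ) + 1) * y (i - 1) * x i ^ 1 * x (i + 1)
             else -(y (k - 3) * x (k - 2) ^ (1 + 1)) - (((1 : ℕ) : ℂ) + 1) * y (k - 2) * x 0 * x (k - 1) ^ 1) = 0) ∧
        (∀ j < k, (N : ℂ) * (x j ^ (1 + 2) + (((1 : ℕ) : ℂ) + 3) * y j ^ (1 + 2)) +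
            (if j + 3 ≤ k then -(x (j + 1) ^ (1 + 1) * x (j + 2))
             else if j + 2 = k then -(x 0 * x (k - 1) ^ (1 + 1))
             else 0) = 0) ) :=
  SigmaFamilySmoothAll.sigma_member_nonsingular k hk 1 le_rfl N hN a b x y hne

end Summit.HodgeConjecture.HodgeConjecture.HodgeLocus.Census.SigmaFamilySmoothSharp
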